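import Literature.NumberTheory.ZetaValues.CohenRivoalProofs
import HarnessLib

/-!
# Koecher's and Almkvist–Granville's generating functions of odd zeta values, unconditionally

Topic `Literature/NumberTheory/ZetaValues`. `AperyLikeGeneratingFunctions.lean` PROVES Koecher's generating function
(1–2) of the `ζ(2s+3)` (`koecher_of_theorem11`) and Almkvist–Granville's (1–3) of the `ζ(4s+3)`
(`almkvistGranville_of_theorem11`) from the named fact `rivoal2004_theorem11`; `CohenRivoalProofs.lean` discharges that
fact (`rivoal2004_theorem11_holds`). This file records the two generating functions as hypothesis-free theorems, so that
users need not know the route: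
* "Koecher (and independently Leshchiner …) proved that
  `Σ_{n≥1} 1/(n(n²−a²)) = ½ Σ_{k≥1} ((−1)^{k+1}/(C(2k,k)k³)) (5k²−a²)/(k²−a²) ∏_{n=1}^{k−1}(1 − a²/n²)` for any complex number
  `a` such that `|a| < 1`" [Rivoal2004, (1–2) p. 504; Koecher1980];
* "Almkvist and Granville proved another identity, first [found] by Borwein and Bradley:
  `Σ_{n≥1} n/(n⁴−b⁴) = ½ Σ_{k≥1} ((−1)^{k+1}/C(2k,k)) (5k/(k⁴−b⁴)) ∏_{n=1}^{k−1} (n⁴+4b⁴)/(n⁴−b⁴)` for any complex number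
  `b` such that `|b| < 1`" [Rivoal2004, (1–3) p. 504; AlmkvistGranville1999; BorweinBaileyGirgensohn2004, Thm 3.2].
-/

noncomputable section

namespace Literature.NumberTheory.ZetaValues

/-- **Koecher 1980 / Leshchiner 1981 — the generating function of `ζ(2s+3)`**, unconditionally: for complex `|a| < 1`,
`Σ_{n≥1} 1/(n(n²−a²)) = ½ Σ_{k≥1} ((−1)^{k+1}/(C(2k,k)k³)) (5k²−a²)/(k²−a²) ∏_{n=1}^{k−1}(1 − a²/n²)`
(`koecher_of_theorem11` applied to `rivoal2004_theorem11_holds`).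
[cite: Koecher1980, (the generating function of ζ(2n+3))] [cite: Rivoal2004, (1–2) p. 504] -/
theorem koecher_generatingFunction (a : ℂ) (ha : ‖a‖ < 1) :
    ∑' n : ℕ, 1 / (((n + 1 : ℕ) : ℂ) * (((n + 1 : ℕ) : ℂ) ^ 2 - a ^ 2)) =
      (1 / 2 : ℂ) * ∑' k : ℕ,
        (-1) ^ (k + 2) / (((k + 1).centralBinom : ℂ) * ((k + 1 : ℕ) : ℂ) ^ 3) *
          ((5 * ((k + 1 : ℕ) : ℂ) ^ 2 - a ^ 2) / (((k + 1 : ℕ) : ℂ) ^ 2 - a ^ 2)) *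
          ∏ n ∈ Finset.Ico 1 (k + 1), (1 - a ^ 2 / (n : ℂ) ^ 2) :=
  koecher_of_theorem11 rivoal2004_theorem11_holds a ha

/-- **Almkvist–Granville 1999 (Borwein–Bradley 1997) — the generating function of `ζ(4s+3)`**, unconditionally: for
complex `|b| < 1`, `Σ_{n≥1} n/(n⁴−b⁴) = ½ Σ_{k≥1} ((−1)^{k+1}/C(2k,k)) (5k/(k⁴−b⁴)) ∏_{n=1}^{k−1} (n⁴+4b⁴)/(n⁴−b⁴)`
(`almkvistGranville_of_theorem11` applied to `rivoal2004_theorem11_holds`).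
[cite: AlmkvistGranville1999, Theorem (the Borwein–Bradley formula)] [cite: Rivoal2004, (1–3) p. 504]
[cite: BorweinBaileyGirgensohn2004, Theorem 3.2 (3.20) p. 96] -/
theorem almkvistGranville_generatingFunction (b : ℂ) (hb : ‖b‖ < 1) :
    ∑' n : ℕ, ((n + 1 : ℕ) : ℂ) / (((n + 1 : ℕ) : ℂ) ^ 4 - b ^ 4) =
      (1 / 2 : ℂ) * ∑' k : ℕ,
        (-1) ^ (k + 2) / ((k + 1).centralBinom : ℂ) * (5 * ((k + 1 : ℕ) : ℂ) / (((k + 1 : ℕ) : ℂ) ^ 4 - b ^ 4)) *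
          ∏ n ∈ Finset.Ico 1 (k + 1), ((n : ℂ) ^ 4 + 4 * b ^ 4) / ((n : ℂ) ^ 4 - b ^ 4) :=
  almkvistGranville_of_theorem11 rivoal2004_theorem11_holds b hb

end Literature.NumberTheory.ZetaValues
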